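import Summits.CriticalPhenomena.PercolationContinuityZ3.Theorems.PercNearOneGluingNoHeavyConstsUnconditionalChainRule
import Mathlib.LinearAlgebra.Matrix.Determinant.Basic
import HarnessLib
import HarnessLib.Audit.Tags

/-!
# The single-edge chain rule is SANDWICHED: `Δ = K(xuv,Y)·T₁ + K(xuv,Yo)·T₂` with `T₁ ≥ 0` (the unconditional chain rule)
# and `T₂ ≤ 0` (the reverse-regularity gap bound) both PROVED (PAPER-2 track (ii), constants of the CSH family)

builds on p205010 (kernel theorem, internal audit signed; external expert review pending).  Support file (`--supports
stmt-CriticalPhenomena-4575`), seat `prim-consts-2` (gen 4); rows A6/A11 of `run/shared/lean/prim/consts/CONSTANTS.md`; memo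
`run/shared/lean/prim/consts/FROM-prim-consts-2-g4-BERNSTEIN.md` §9.  No definitions, no sorries; standard axioms.

Notation: `μ = prodBernoulli w`, `K(S,T) = μ{S ↮ T}`, chain-rule data `x, u, v, o, Y` (`Consts.SingleEdgeChainRule`),
`Yv = Y ∪ {v}`, `Yo = Y ∪ {o}`; `Δ = det[K(S_i,T_j)]` with rows `{x} ⊂ {x,u} ⊂ {x,u,v}` and columns `Yv, Y, Yo` is the chain-rule
slack (`Consts.singleEdgeChainRule_slack_eq_det`).  With
  `T₁ = K(xu,Yv)·[K(x,Yo) − K(xu,Yo)] − [K(x,Yv) − K(xu,Yv)]·[K(xu,Yo) − K(xuv,Yo)]` (`≥ 0`, `Consts.unconditionalChainRule`),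
  `T₂ = [K(x,Yv)K(xu,Y) − K(xu,Yv)K(x,Y)] − K(xuv,Y)·[K(x,Yv) − K(xu,Yv)]`:

* `Consts.rr2Gap_le` — **THEOREM `T₂ ≤ 0`**: `K(x,Yv)·[K(xu,Y) − K(xuv,Y)] ≤ K(xu,Yv)·[K(x,Y) − K(xuv,Y)]`, i.e. the gap of the
  reverse-regularity inequality `Consts.disconnect_rr2` is at most `K(xuv,Y)·[K(x,Yv) − K(xu,Yv)]`.  Proof: van den
  Berg–Häggström–Kahn Thm 1.3 for the source SET `Y ∪ {v}` avoiding `x` (`{v ↔ Y}` increasing, `{u ∉ C}` decreasing), then the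
  inclusion `{Yv ↮ x, v ↔ Y} ⊆ {x ↮ Y} ∖ {xuv ↮ Y}`.
* `Consts.chainRule_det_eq_sandwich` — **IDENTITY** `Δ = K(xuv,Y)·T₁ + K(xuv,Yo)·T₂` (expansion along the third row, whose first
  entry `K(xuv,Yv)` vanishes).
* `Consts.singleEdgeChainRule_iff_sandwich` — `Consts.SingleEdgeChainRule ⟺ K(xuv,Yo)·(−T₂) ≤ K(xuv,Y)·T₁` for all data: the open
  chain rule is a weighted comparison of two proved nonnegative quantities, the weights `K(xuv,Yo) ≤ K(xuv,Y)` in its favour.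
  In the three-copy language of `Consts.ChainRuleBernstein`: `T₁ ≥ 0` is the annealed pattern inequality `#(1,3,2) ≤ #(2,3,1)`,
  `T₂ ≤ 0` is `#(1,2,3) ≤ #(2,1,3)`, and the chain rule says the first surplus outweighs the second.
[cite: VandenbergHaggstromKahn2005, Thm. 1.3 (p. 6), Thm. 1.5 (p. 7), Remark 1 after Thm. 1.2 (p. 5), Thm. 1.1 (pp. 3–5)]
-/

noncomputable section

namespace Summit.CriticalPhenomena.PercolationContinuityZ3.Theorems

open MeasureTheory Set Literature.Probability.LatticeModels Literature.Probability.Percolation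
open scoped Classical

namespace Consts

variable {V : Type*} [Fintype V]

/-- **THEOREM `T₂ ≤ 0` — an upper bound for the reverse-regularity gap.**  For every finite weighted graph and all `x, u, v, Y`:
`K(x,Yv) · [K(xu,Y) − K(xuv,Y)] ≤ K(xu,Yv) · [K(x,Y) − K(xuv,Y)]`, i.e. `μ(x↮Yv)·μ(xu↮Y, v↔Y) ≤ μ(xu↮Yv)·μ(x↮Y, {u,v} meets C_Y)`;
equivalently the gap `K(x,Yv)K(xu,Y) − K(xu,Yv)K(x,Y) ≥ 0` of `Consts.disconnect_rr2` is at most `K(xuv,Y)·[K(x,Yv) − K(xu,Yv)]`.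
Proof: vdBHK Thm 1.3 for the source set `Y ∪ {v}` avoiding `x` (`{v ↔ Y}` increasing, `{u ∉ C}` decreasing), then
`{Yv ↮ x, v ↔ Y} ⊆ {x ↮ Y} ∖ {xuv ↮ Y}`.
[cite: VandenbergHaggstromKahn2005, Thm. 1.3 (p. 6), Remark 1 after Thm. 1.2 (p. 5)] -/
theorem rr2Gap_le (w : Sym2 V → unitInterval) (x u v : V) (Y : Set V) :
    (prodBernoulli w).real {ω : BondConfig V | ∀ s ∈ ({x} : Set V), ∀ t ∈ insert v Y, ¬ (openGraph ω).Reachable s t} *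
      ((prodBernoulli w).real {ω : BondConfig V | ∀ s ∈ ({x, u} : Set V), ∀ t ∈ Y, ¬ (openGraph ω).Reachable s t} -
        (prodBernoulli w).real {ω : BondConfig V | ∀ s ∈ ({x, u, v} : Set V), ∀ t ∈ Y, ¬ (openGraph ω).Reachable s t}) ≤
    (prodBernoulli w).real {ω : BondConfig V | ∀ s ∈ ({x, u} : Set V), ∀ t ∈ insert v Y, ¬ (openGraph ω).Reachable s t} *
      ((prodBernoulli w).real {ω : BondConfig V | ∀ s ∈ ({x} : Set V), ∀ t ∈ Y, ¬ (openGraph ω).Reachable s t} -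
        (prodBernoulli w).real {ω : BondConfig V | ∀ s ∈ ({x, u, v} : Set V), ∀ t ∈ Y, ¬ (openGraph ω).Reachable s t}) := by
  classical
  set μ := prodBernoulli w with hμ
  have hmeas : ∀ T : Set (BondConfig V), MeasurableSet T := fun _ => MeasurableSet.of_discrete
  set σ : Set V := insert v Y with hσ
  have hvσ : ({v} : Set V) ⊆ σ := singleton_subset_iff.2 (mem_insert _ _)
  have hYσ : Y ⊆ σ := subset_insert _ _
  have hxxu : ({x} : Set V) ⊆ ({x, u} : Set V) := singleton_subset_iff.2 (mem_insert _ _)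
  set Dσ : Set (BondConfig V) := {ω | ∀ s ∈ σ, ∀ t ∈ ({x} : Set V), ¬ (openGraph ω).Reachable s t} with hDσ
  set Dσu : Set (BondConfig V) := {ω | ∀ s ∈ σ, ∀ t ∈ ({x, u} : Set V), ¬ (openGraph ω).Reachable s t} with hDσu
  set E₁ : Set (BondConfig V) := {ω | ∃ s ∈ ({v} : Set V), ∃ a ∈ Y, (openGraph ω).Reachable s a} with hE₁
  set E₂ : Set (BondConfig V) := {ω | ∃ s ∈ σ, ∃ a ∈ ({u} : Set V), (openGraph ω).Reachable s a} with hE₂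
  have hDσu_eq : Dσ ∩ E₂ᶜ = Dσu := by
    ext ω
    constructor
    · rintro ⟨h1, h2⟩ s hs t ht
      rcases (show t = x ∨ t = u by simpa using ht) with rfl | rfl
      · exact h1 s hs t (mem_singleton _)
      · exact fun h => h2 ⟨s, hs, t, mem_singleton _, h⟩
    · intro h
      refine ⟨fun s hs t ht => ?_, ?_⟩
      · rw [mem_singleton_iff] at ht; subst ht
        exact h s hs t (by simp)
      · rintro ⟨s, hs, a, ha, hsa⟩
        rw [mem_singleton_iff] at ha; subst ha
        exact h s hs a (by simp) hsa
  -- `K(xu,Y) − K(xuv,Y) = μ(Dσu ∩ E₁)`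
  have hb : μ.real {ω : BondConfig V | ∀ s ∈ ({x, u} : Set V), ∀ t ∈ Y, ¬ (openGraph ω).Reachable s t} -
      μ.real {ω : BondConfig V | ∀ s ∈ ({x, u, v} : Set V), ∀ t ∈ Y, ¬ (openGraph ω).Reachable s t} =
      μ.real (Dσu ∩ E₁) := by
    have hsub : {ω : BondConfig V | ∀ s ∈ ({x, u, v} : Set V), ∀ t ∈ Y, ¬ (openGraph ω).Reachable s t} ⊆
        {ω : BondConfig V | ∀ s ∈ ({x, u} : Set V), ∀ t ∈ Y, ¬ (openGraph ω).Reachable s t} := by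
      intro ω h s hs t ht
      rcases (show s = x ∨ s = u by simpa using hs) with rfl | rfl
      · exact h s (by simp) t ht
      · exact h s (by simp) t ht
    have hdiff : {ω : BondConfig V | ∀ s ∈ ({x, u} : Set V), ∀ t ∈ Y, ¬ (openGraph ω).Reachable s t} \
        {ω : BondConfig V | ∀ s ∈ ({x, u, v} : Set V), ∀ t ∈ Y, ¬ (openGraph ω).Reachable s t} = Dσu ∩ E₁ := by
      ext ω
      constructor
      · rintro ⟨hA, hB⟩
        have hA' : ∀ s ∈ ({x, u} : Set V), ∀ t ∈ Y, ¬ (openGraph ω).Reachable s t := hA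
        have hv : ∃ a ∈ Y, (openGraph ω).Reachable v a := by
          by_contra hno
          apply hB
          intro s hs t ht
          rcases (show s = x ∨ s = u ∨ s = v by simpa using hs) with rfl | rfl | rfl
          · exact hA' s (by simp) t ht
          · exact hA' s (by simp) t ht
          · exact fun h => hno ⟨t, ht, h⟩
        obtain ⟨a, ha, hva⟩ := hv
        refine ⟨fun s hs t ht => ?_, ⟨v, mem_singleton _, a, ha, hva⟩⟩
        rcases (mem_insert_iff.1 hs) with rfl | hs'
        · exact fun h => hA' t ht a ha (h.symm.trans hva)
        · exact fun h => hA' t ht s hs' h.symm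
      · rintro ⟨hD, s, hs, a, ha, hsa⟩
        rw [mem_singleton_iff] at hs; subst hs
        refine ⟨fun s' hs' t ht h => hD t (hYσ ht) s' hs' h.symm, fun hall => ?_⟩
        exact hall s (by simp) a ha hsa
    rw [← measureReal_sdiff hsub (hmeas _), hdiff]
  -- `μ(Dσ ∩ E₁) ≤ K(x,Y) − K(xuv,Y)`
  have hd : μ.real (Dσ ∩ E₁) ≤ μ.real {ω : BondConfig V | ∀ s ∈ ({x} : Set V), ∀ t ∈ Y, ¬ (openGraph ω).Reachable s t} -
      μ.real {ω : BondConfig V | ∀ s ∈ ({x, u, v} : Set V), ∀ t ∈ Y, ¬ (openGraph ω).Reachable s t} := by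
    have hsub : {ω : BondConfig V | ∀ s ∈ ({x, u, v} : Set V), ∀ t ∈ Y, ¬ (openGraph ω).Reachable s t} ⊆
        {ω : BondConfig V | ∀ s ∈ ({x} : Set V), ∀ t ∈ Y, ¬ (openGraph ω).Reachable s t} := by
      intro ω h s hs t ht
      rw [mem_singleton_iff] at hs; subst hs
      exact h s (by simp) t ht
    rw [← measureReal_sdiff hsub (hmeas _)]
    refine measureReal_mono ?_
    rintro ω ⟨hD, ⟨s, hs, a, ha, hsa⟩⟩
    rw [mem_singleton_iff] at hs; subst hs
    refine ⟨fun s' hs' t ht h => ?_, fun hall => ?_⟩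
    · rw [mem_singleton_iff] at hs'; subst hs'
      exact hD t (hYσ ht) s' (mem_singleton _) h.symm
    · have hall' : ∀ s' ∈ ({x, u, s} : Set V), ∀ t ∈ Y, ¬ (openGraph ω).Reachable s' t := hall
      exact hall' s (by simp) a ha hsa
  -- vdBHK: `μ(Dσu ∩ E₁) μ(Dσ) ≤ μ(Dσ ∩ E₁) μ(Dσu)`
  have h1 : μ.real (Dσu ∩ E₁) * μ.real Dσ ≤ μ.real (Dσ ∩ E₁) * μ.real Dσu := by
    have := real_avoid_conn_notConn_mul_le w σ ({x} : Set V) hvσ subset_rfl Y ({u} : Set V)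
    have hset : Dσ ∩ E₁ ∩ E₂ᶜ = Dσu ∩ E₁ := by
      rw [inter_assoc, inter_comm E₁ E₂ᶜ, ← inter_assoc, hDσu_eq]
    rw [hset, hDσu_eq] at this
    exact this
  rw [setOf_avoid_comm ({x} : Set V) (insert v Y), setOf_avoid_comm ({x, u} : Set V) (insert v Y), hb]
  calc μ.real Dσ * μ.real (Dσu ∩ E₁) = μ.real (Dσu ∩ E₁) * μ.real Dσ := mul_comm _ _
    _ ≤ μ.real (Dσ ∩ E₁) * μ.real Dσu := h1
    _ = μ.real Dσu * μ.real (Dσ ∩ E₁) := mul_comm _ _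
    _ ≤ _ := mul_le_mul_of_nonneg_left hd measureReal_nonneg


omit [Fintype V] in
/-- **IDENTITY — the chain-rule determinant splits as `K(xuv,Y)·T₁ + K(xuv,Yo)·T₂`** (expansion along the third row, whose
first entry `K(xuv, Y ∪ v)` vanishes), with `T₁` the unconditional chain-rule quantity of `Consts.unconditionalChainRule` and
`T₂` the corrected reverse-regularity gap of `Consts.rr2Gap_le`.
[cite: VandenbergHaggstromKahn2005, Thm. 1.1 (pp. 3–5)] -/
theorem chainRule_det_eq_sandwich (w : Sym2 V → unitInterval) (x u v o : V) (Y : Set V) :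
    Matrix.det !![
      (prodBernoulli w).real {ω : BondConfig V | ∀ s ∈ ({x} : Set V), ∀ t ∈ insert v Y, ¬ (openGraph ω).Reachable s t},
      (prodBernoulli w).real {ω : BondConfig V | ∀ s ∈ ({x} : Set V), ∀ t ∈ Y, ¬ (openGraph ω).Reachable s t},
      (prodBernoulli w).real {ω : BondConfig V | ∀ s ∈ ({x} : Set V), ∀ t ∈ insert o Y, ¬ (openGraph ω).Reachable s t};
      (prodBernoulli w).real {ω : BondConfig V | ∀ s ∈ ({x, u} : Set V), ∀ t ∈ insert v Y, ¬ (openGraph ω).Reachable s t},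
      (prodBernoulli w).real {ω : BondConfig V | ∀ s ∈ ({x, u} : Set V), ∀ t ∈ Y, ¬ (openGraph ω).Reachable s t},
      (prodBernoulli w).real {ω : BondConfig V | ∀ s ∈ ({x, u} : Set V), ∀ t ∈ insert o Y, ¬ (openGraph ω).Reachable s t};
      (prodBernoulli w).real {ω : BondConfig V | ∀ s ∈ ({x, u, v} : Set V), ∀ t ∈ insert v Y, ¬ (openGraph ω).Reachable s t},
      (prodBernoulli w).real {ω : BondConfig V | ∀ s ∈ ({x, u, v} : Set V), ∀ t ∈ Y, ¬ (openGraph ω).Reachable s t},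
      (prodBernoulli w).real {ω : BondConfig V | ∀ s ∈ ({x, u, v} : Set V), ∀ t ∈ insert o Y,
        ¬ (openGraph ω).Reachable s t}] =
    (prodBernoulli w).real {ω : BondConfig V | ∀ s ∈ ({x, u, v} : Set V), ∀ t ∈ Y, ¬ (openGraph ω).Reachable s t} *
        ((prodBernoulli w).real {ω : BondConfig V | ∀ s ∈ ({x, u} : Set V), ∀ t ∈ insert v Y, ¬ (openGraph ω).Reachable s t} *
            ((prodBernoulli w).real {ω : BondConfig V | ∀ s ∈ ({x} : Set V), ∀ t ∈ insert o Y, ¬ (openGraph ω).Reachable s t} -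
              (prodBernoulli w).real {ω : BondConfig V | ∀ s ∈ ({x, u} : Set V), ∀ t ∈ insert o Y,
                ¬ (openGraph ω).Reachable s t}) -
          ((prodBernoulli w).real {ω : BondConfig V | ∀ s ∈ ({x} : Set V), ∀ t ∈ insert v Y, ¬ (openGraph ω).Reachable s t} -
              (prodBernoulli w).real {ω : BondConfig V | ∀ s ∈ ({x, u} : Set V), ∀ t ∈ insert v Y,
                ¬ (openGraph ω).Reachable s t}) *
            ((prodBernoulli w).real {ω : BondConfig V | ∀ s ∈ ({x, u} : Set V), ∀ t ∈ insert o Y,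
                ¬ (openGraph ω).Reachable s t} -
              (prodBernoulli w).real {ω : BondConfig V | ∀ s ∈ ({x, u, v} : Set V), ∀ t ∈ insert o Y,
                ¬ (openGraph ω).Reachable s t})) +
      (prodBernoulli w).real {ω : BondConfig V | ∀ s ∈ ({x, u, v} : Set V), ∀ t ∈ insert o Y,
          ¬ (openGraph ω).Reachable s t} *
        (((prodBernoulli w).real {ω : BondConfig V | ∀ s ∈ ({x} : Set V), ∀ t ∈ insert v Y, ¬ (openGraph ω).Reachable s t} *
              (prodBernoulli w).real {ω : BondConfig V | ∀ s ∈ ({x, u} : Set V), ∀ t ∈ Y, ¬ (openGraph ω).Reachable s t} -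
            (prodBernoulli w).real {ω : BondConfig V | ∀ s ∈ ({x, u} : Set V), ∀ t ∈ insert v Y,
                ¬ (openGraph ω).Reachable s t} *
              (prodBernoulli w).real {ω : BondConfig V | ∀ s ∈ ({x} : Set V), ∀ t ∈ Y, ¬ (openGraph ω).Reachable s t}) -
          (prodBernoulli w).real {ω : BondConfig V | ∀ s ∈ ({x, u, v} : Set V), ∀ t ∈ Y, ¬ (openGraph ω).Reachable s t} *
            ((prodBernoulli w).real {ω : BondConfig V | ∀ s ∈ ({x} : Set V), ∀ t ∈ insert v Y, ¬ (openGraph ω).Reachable s t} -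
              (prodBernoulli w).real {ω : BondConfig V | ∀ s ∈ ({x, u} : Set V), ∀ t ∈ insert v Y,
                ¬ (openGraph ω).Reachable s t})) := by
  classical
  have hK3v0 : (prodBernoulli w).real {ω : BondConfig V | ∀ s ∈ ({x, u, v} : Set V), ∀ t ∈ insert v Y,
      ¬ (openGraph ω).Reachable s t} = 0 := by
    have : {ω : BondConfig V | ∀ s ∈ ({x, u, v} : Set V), ∀ t ∈ insert v Y, ¬ (openGraph ω).Reachable s t} = ∅ := by
      ext ω
      simp only [mem_setOf_eq, mem_empty_iff_false, iff_false, not_forall, not_not]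
      exact ⟨v, by simp, v, mem_insert _ _, SimpleGraph.Reachable.refl _⟩
    rw [this]; simp
  rw [Matrix.det_fin_three]
  simp only [Matrix.of_apply, Matrix.cons_val', Matrix.cons_val_zero, Matrix.cons_val_one, Matrix.cons_val_two,
    Matrix.empty_val', Matrix.cons_val_fin_one, Matrix.head_cons, Matrix.tail_cons, Matrix.head_fin_const, hK3v0]
  ring

/-- **The chain rule as a weighted comparison of two proved inequalities.**  `Consts.SingleEdgeChainRule` holds iff for all
finite weighted graphs on `Fin n` and all `x, u, v, o, Y`:  `K(xuv,Yo) · (−T₂) ≤ K(xuv,Y) · T₁`, where `T₁ ≥ 0`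
(`Consts.unconditionalChainRule`) and `−T₂ ≥ 0` (`Consts.rr2Gap_le`), and `K(xuv,Yo) ≤ K(xuv,Y)`.
[cite: VandenbergHaggstromKahn2005, Thm. 1.1 (pp. 3–5), Thm. 1.3 (p. 6)] -/
theorem singleEdgeChainRule_iff_sandwich :
    SingleEdgeChainRule ↔
      ∀ (n : ℕ) (w : Sym2 (Fin n) → unitInterval) (x u v o : Fin n) (Y : Set (Fin n)),
        (prodBernoulli w).real {ω : BondConfig (Fin n) | ∀ s ∈ ({x, u, v} : Set (Fin n)), ∀ t ∈ insert o Y,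
            ¬ (openGraph ω).Reachable s t} *
          ((prodBernoulli w).real {ω : BondConfig (Fin n) | ∀ s ∈ ({x, u, v} : Set (Fin n)), ∀ t ∈ Y,
                ¬ (openGraph ω).Reachable s t} *
              ((prodBernoulli w).real {ω : BondConfig (Fin n) | ∀ s ∈ ({x} : Set (Fin n)), ∀ t ∈ insert v Y,
                  ¬ (openGraph ω).Reachable s t} -
                (prodBernoulli w).real {ω : BondConfig (Fin n) | ∀ s ∈ ({x, u} : Set (Fin n)), ∀ t ∈ insert v Y,
                  ¬ (openGraph ω).Reachable s t}) -
            ((prodBernoulli w).real {ω : BondConfig (Fin n) | ∀ s ∈ ({x} : Set (Fin n)), ∀ t ∈ insert v Y,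
                  ¬ (openGraph ω).Reachable s t} *
                (prodBernoulli w).real {ω : BondConfig (Fin n) | ∀ s ∈ ({x, u} : Set (Fin n)), ∀ t ∈ Y,
                  ¬ (openGraph ω).Reachable s t} -
              (prodBernoulli w).real {ω : BondConfig (Fin n) | ∀ s ∈ ({x, u} : Set (Fin n)), ∀ t ∈ insert v Y,
                  ¬ (openGraph ω).Reachable s t} *
                (prodBernoulli w).real {ω : BondConfig (Fin n) | ∀ s ∈ ({x} : Set (Fin n)), ∀ t ∈ Y,
                  ¬ (openGraph ω).Reachable s t})) ≤
        (prodBernoulli w).real {ω : BondConfig (Fin n) | ∀ s ∈ ({x, u, v} : Set (Fin n)), ∀ t ∈ Y,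
            ¬ (openGraph ω).Reachable s t} *
          ((prodBernoulli w).real {ω : BondConfig (Fin n) | ∀ s ∈ ({x, u} : Set (Fin n)), ∀ t ∈ insert v Y,
                ¬ (openGraph ω).Reachable s t} *
              ((prodBernoulli w).real {ω : BondConfig (Fin n) | ∀ s ∈ ({x} : Set (Fin n)), ∀ t ∈ insert o Y,
                  ¬ (openGraph ω).Reachable s t} -
                (prodBernoulli w).real {ω : BondConfig (Fin n) | ∀ s ∈ ({x, u} : Set (Fin n)), ∀ t ∈ insert o Y,
                  ¬ (openGraph ω).Reachable s t}) -
            ((prodBernoulli w).real {ω : BondConfig (Fin n) | ∀ s ∈ ({x} : Set (Fin n)), ∀ t ∈ insert v Y,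
                  ¬ (openGraph ω).Reachable s t} -
                (prodBernoulli w).real {ω : BondConfig (Fin n) | ∀ s ∈ ({x, u} : Set (Fin n)), ∀ t ∈ insert v Y,
                  ¬ (openGraph ω).Reachable s t}) *
              ((prodBernoulli w).real {ω : BondConfig (Fin n) | ∀ s ∈ ({x, u} : Set (Fin n)), ∀ t ∈ insert o Y,
                  ¬ (openGraph ω).Reachable s t} -
                (prodBernoulli w).real {ω : BondConfig (Fin n) | ∀ s ∈ ({x, u, v} : Set (Fin n)), ∀ t ∈ insert o Y,
                  ¬ (openGraph ω).Reachable s t})) := by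
  rw [singleEdgeChainRule_iff_det_nonneg]
  refine forall_congr' fun n => forall_congr' fun w => forall_congr' fun x => forall_congr' fun u =>
    forall_congr' fun v => forall_congr' fun o => forall_congr' fun Y => ?_
  rw [chainRule_det_eq_sandwich w x u v o Y]
  constructor
  · intro h; linarith
  · intro h; linarith

end Consts

end Summit.CriticalPhenomena.PercolationContinuityZ3.Theorems

end
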